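import Literature.AlgebraicGeometry.Frobenioids.PreFrobenioidEquivalence
import Mathlib.CategoryTheory.Conj
import HarnessLib

/-!
# Frobenioids I, Theorem 4.2 (i): `Ψ` preserves Div-Frobenius-trivial and universally
# Div-Frobenius-trivial objects — the formal reduction to Div-identity endomorphisms

Mochizuki, *The geometry of Frobenioids I: the general theory*, Kyushu J. Math. **62** (2008)
293–400, §4, Theorem 4.2 (i), kurims text pp. 77–78 [cite: MochizukiFrdI2008, Thm. 4.2 (i) p.77]:
"(i) `Ψ` preserves primary steps, Div-identity endomorphisms, Div-Frobenius-trivial objects, and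
universally Div-Frobenius-trivial objects"; proof p. 78: "by Proposition 1.14, (v) [cf. also Theorem
3.4, (ii)], it follows immediately that `Ψ` preserves non-group-like Div-Frobenius-trivial objects …
Since `Ψ` preserves morphisms of Frobenius type and Frobenius degrees [cf. Theorem 3.4, (iii)] …" and,
for the universal variant, "`Ψ` preserves … pull-back morphisms [cf. Theorem 3.4, (iii)]".

PROVED here, as the FORMAL part of those two clauses: for pre-Frobenioids `C_i → F_{Φ_i}` and an
equivalence `Ψ` that preserves morphisms of Frobenius type and Frobenius degrees [Thm. 3.4 (iii)] and
the Div-identity endomorphisms of the object in question [Prop. 1.14 (v) / Thm. 4.2 (i)] — HYPOTHESES —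
`Ψ` maps a Div-Frobenius-trivial `A` to a Div-Frobenius-trivial `Ψ A` (`isDivFrobeniusTrivial_map`);
if moreover `Ψ⁻¹` preserves pull-back morphisms [Thm. 3.4 (iii) for `Ψ⁻¹`] and the Div-identity
hypothesis holds at the domains of pull-back morphisms into `A`, then `Ψ` maps a universally
Div-Frobenius-trivial `A` to a universally Div-Frobenius-trivial `Ψ A`
(`isUniversallyDivFrobeniusTrivial_map`). Tools: Div-identity / Frobenius-type / degree are invariant
under conjugation by an isomorphism, hence Div-Frobenius-triviality is invariant under isomorphism
(`IsDivFrobeniusTrivial.of_iso`). Composition is diagrammatic. No new definitions.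
-/

namespace Literature.AlgebraicGeometry.Frobenioids

open CategoryTheory Opposite

namespace PreFrobenioid

universe w v v' u u' w₂ v₂ v₂' u₂ u₂'

variable {D : Type u} [Category.{v} D] {Φ : Dᵒᵖ ⥤ CommMonCat.{w}}
  {C : Type u'} [Category.{v'} C] {F : C ⥤ ElemFrobenioid Φ}

/-- A Div-identity endomorphism conjugated by an isomorphism is a Div-identity endomorphism.
[cite: MochizukiFrdI2008, Def. 1.2(ii) p.21] -/
theorem IsDivIdentity.conj {X Y : C} (e : X ≅ Y) {α : X ⟶ X} (hα : IsDivIdentity F α) :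
    IsDivIdentity F (e.inv ≫ α ≫ e.hom) := by
  unfold IsDivIdentity at hα ⊢
  ext x
  rw [base_comp, base_comp, pull_comp, pull_comp, show pull Φ (Base F α) (pull Φ (Base F e.hom) x) =
    pull Φ (Base F e.hom) x from by rw [hα]; rfl, ← pull_comp, ← base_comp, e.inv_hom_id, base_id,
    pull_id]
  rfl

/-- **Div-Frobenius-triviality is invariant under isomorphism** (conjugate the family of Div-identity
endomorphisms of Frobenius type). [cite: MochizukiFrdI2008, Def. 1.2(iv) p.23] -/
theorem IsDivFrobeniusTrivial.of_iso (hP : IsPreFrobenioid Φ F) {X Y : C} (e : X ≅ Y)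
    (h : IsDivFrobeniusTrivial F X) : IsDivFrobeniusTrivial F Y := by
  obtain ⟨ζ, hζ⟩ := h
  refine ⟨e.conj.toMonoidHom.comp ζ, fun n => ?_⟩
  obtain ⟨hdeg, hdiv, hfr⟩ := hζ n
  have happ : (e.conj.toMonoidHom.comp ζ) n = (e.inv ≫ (ζ n : X ⟶ X) ≫ e.hom : Y ⟶ Y) :=
    Iso.conj_apply e (ζ n)
  refine ⟨?_, ?_, ?_⟩
  · rw [happ, degFr_iso_comp, degFr_comp_iso, hdeg]
  · rw [happ]; exact hdiv.conj e
  · rw [happ]; exact (hfr.comp_iso hP e.hom).iso_comp hP e.inv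

variable {D₂ : Type u₂} [Category.{v₂} D₂] {Φ₂ : D₂ᵒᵖ ⥤ CommMonCat.{w₂}}
  {C₂ : Type u₂'} [Category.{v₂'} C₂] {F₂ : C₂ ⥤ ElemFrobenioid Φ₂} (Ψ : C ≌ C₂)

/-- **Theorem 4.2 (i), Div-Frobenius-trivial objects** (formal part, FrdI p. 78): if `Ψ` preserves
morphisms of Frobenius type and Frobenius degrees [Thm. 3.4 (iii)] and the Div-identity endomorphisms
of `A` [Prop. 1.14 (v) / Thm. 4.2 (i)] — hypotheses — then `Ψ A` is Div-Frobenius-trivial whenever `A`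
is (transport the family `ζ` along the monoid homomorphism `End A → End (Ψ A)`).
[cite: MochizukiFrdI2008, Thm. 4.2 (i) p.77] -/
theorem isDivFrobeniusTrivial_map
    (hfrob : ∀ ⦃X Y : C⦄ (φ : X ⟶ Y), IsFrobeniusType F φ → IsFrobeniusType F₂ (Ψ.functor.map φ))
    (hdeg : ∀ ⦃X Y : C⦄ (φ : X ⟶ Y), degFr F₂ (Ψ.functor.map φ) = degFr F φ)
    {A : C} (hdivid : ∀ α : A ⟶ A, IsDivIdentity F α → IsDivIdentity F₂ (Ψ.functor.map α))
    (hA : IsDivFrobeniusTrivial F A) : IsDivFrobeniusTrivial F₂ (Ψ.functor.obj A) := by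
  obtain ⟨ζ, hζ⟩ := hA
  refine ⟨(Ψ.functor.mapEnd A).comp ζ, fun n => ?_⟩
  obtain ⟨hd, hdi, hfr⟩ := hζ n
  have happ : ((Ψ.functor.mapEnd A).comp ζ) n = (Ψ.functor.map (ζ n : A ⟶ A) : _ ⟶ _) := rfl
  rw [happ]
  exact ⟨(hdeg _).trans hd, hdivid _ hdi, hfrob _ hfr⟩

set_option backward.isDefEq.respectTransparency false in
/-- **Theorem 4.2 (i), universally Div-Frobenius-trivial objects** (formal part, FrdI p. 78): if
moreover `Ψ⁻¹` preserves pull-back morphisms [Thm. 3.4 (iii)] and the Div-identity hypothesis holds at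
the domain of every pull-back morphism into `A`, then `Ψ A` is universally Div-Frobenius-trivial
whenever `A` is. [cite: MochizukiFrdI2008, Thm. 4.2 (i) p.77] -/
theorem isUniversallyDivFrobeniusTrivial_map (hP₂ : IsPreFrobenioid Φ₂ F₂)
    (hfrob : ∀ ⦃X Y : C⦄ (φ : X ⟶ Y), IsFrobeniusType F φ → IsFrobeniusType F₂ (Ψ.functor.map φ))
    (hdeg : ∀ ⦃X Y : C⦄ (φ : X ⟶ Y), degFr F₂ (Ψ.functor.map φ) = degFr F φ)
    (hpb' : ∀ ⦃X Y : C₂⦄ (φ : X ⟶ Y), IsPullbackMorphism F₂ φ → IsPullbackMorphism F (Ψ.inverse.map φ))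
    {A : C}
    (hdivid : ∀ ⦃A' : C⦄ (ψ : A' ⟶ A), IsPullbackMorphism F ψ →
      ∀ α : A' ⟶ A', IsDivIdentity F α → IsDivIdentity F₂ (Ψ.functor.map α))
    (hA : IsUniversallyDivFrobeniusTrivial F A) :
    IsUniversallyDivFrobeniusTrivial F₂ (Ψ.functor.obj A) := by
  intro A₂ ψ hψ
  -- `Ψ⁻¹ψ` followed by the unit is a pull-back morphism into `A`
  set ψ₁ : Ψ.inverse.obj A₂ ⟶ A := Ψ.inverse.map ψ ≫ Ψ.unitInv.app A with hψ₁
  have hψ₁pb : IsPullbackMorphism F ψ₁ :=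
    IsPullbackMorphism.comp F (hpb' ψ hψ) (isPullbackMorphism_of_isIso F _)
  have h1 : IsDivFrobeniusTrivial F₂ (Ψ.functor.obj (Ψ.inverse.obj A₂)) :=
    isDivFrobeniusTrivial_map Ψ hfrob hdeg (hdivid ψ₁ hψ₁pb) (hA ψ₁ hψ₁pb)
  exact h1.of_iso hP₂ (Ψ.counitIso.app A₂)

end PreFrobenioid

end Literature.AlgebraicGeometry.Frobenioids
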